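import Mathlib
import Summits.AtomisticToContinuum.Crystallization.Theses.PricedLinkCensus
import Summits.AtomisticToContinuum.Crystallization.Theorems.ChargedEnergyGap.Negative.Unconditional
import Literature.MathematicalPhysics.StatisticalMechanics.LennardJonesClusters
import Literature.MathematicalPhysics.StatisticalMechanics.BarlowStacking
import Literature.MathematicalPhysics.StatisticalMechanics.HaggStacking

/-!
# Route PricedLinkCensus — the squeeze of line Sketch (priced hcp windows) for `StackingHinge`
(stub `stub_hcpCharged_of_priced` of line Sketch, stmt-AtomisticToContinuum-14993)

Fix an hcp scale `(a, h)` and suppose the PRICED INEQUALITY of the line holds for it: for all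
`(δ₀, R, ε)` there are `κ > 0`, `L > 0`, `C` with

  `N·e* + κ·#U − C·#B ≤ E_LJ(y)`   for every injective `δ₀`-separated `y : Fin N → ℝ³`,

where `e* = ⨅_Q e_LJ(Q)` is the periodic infimum, `B` is the set of sites `i` whose
`L·nn_i`-window contains a site that is not charge-free at tolerance `1/100`, and `U` is the set
of sites outside `B` whose `R`-window is NOT two-way `ε`-matched with a rigid image of the hcp
stacking `barlowStacking a h alternatingHagg`.  Suppose also `ChargeFreeWindows`.  Then along
every sequence `x N` of Lennard-Jones ground states and for every window `(R, ε)` the matched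
sites `M` have density `≥ 1/2` eventually, a fortiori `∃ ρ > 0, ∃ᶠ N, ρ N ≤ #M`.

Proof.  `δ₀` from `LennardJonesMinimalDistance_holds`; `κ, L, C` from the hypothesis; a ground
state is injective, `δ₀`-separated and has `interactionEnergy = E(N)`; `E(N)/N → e*`
(`ChargedEnergyGapNegative.crysEnergyLimit`) and `#B/N → 0` (`ChargeFreeWindows` at radius `L`);
every site lies in `B`, in `U` or in `M`, so
`#M/N ≥ 1 − #B/N − ((E(N)/N − e*) + C·#B/N)/κ → 1`.

All `[folklore]`; pure bookkeeping (Mathlib filters and `Set.ncard`).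
-/

namespace Summit.AtomisticToContinuum.Crystallization.Theorems.PricedHcpWindowsSqueeze

open Filter Topology
open Literature.MathematicalPhysics.StatisticalMechanics
open Literature.Geometry.DiscreteGeometry

/-! ### Counting: a three-way cover -/

/-- Every index `i : Fin N` satisfies `¬ p i`, or `p i ∧ ¬ q i`, or `q i`; hence `N` is at most
the sum of the three corresponding subtype cardinalities. [folklore] -/
theorem card_fin_le_three_cover (N : ℕ) (p q : Fin N → Prop) :
    N ≤ Nat.card {i // ¬ p i} + Nat.card {i // p i ∧ ¬ q i} + Nat.card {i // q i} := by
  have h1 : (Set.univ : Set (Fin N)) ⊆ {i | ¬ p i} ∪ {i | p i ∧ ¬ q i} ∪ {i | q i} := by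
    intro i _
    by_cases hp : p i <;> by_cases hq : q i <;> simp [hp, hq]
  calc N = Nat.card (Fin N) := (Nat.card_fin N).symm
    _ = (Set.univ : Set (Fin N)).ncard := (Set.ncard_univ _).symm
    _ ≤ ({i | ¬ p i} ∪ {i | p i ∧ ¬ q i} ∪ {i | q i}).ncard := Set.ncard_le_ncard h1
    _ ≤ ({i | ¬ p i} ∪ {i | p i ∧ ¬ q i}).ncard + {i | q i}.ncard := Set.ncard_union_le _ _
    _ ≤ {i | ¬ p i}.ncard + {i | p i ∧ ¬ q i}.ncard + {i | q i}.ncard :=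
        Nat.add_le_add_right (Set.ncard_union_le _ _) _
    _ = _ := rfl

/-! ### Analysis: the squeeze on real sequences -/

/-- The squeeze in abstract form.  If `E N / N → e`, `b N / N → 0`, `κ > 0`,
`N e + κ u N − C b N ≤ E N` and `N ≤ b N + u N + m N` for all `N`, then eventually
`N / 2 ≤ m N`: indeed `m N / N ≥ 1 − b N / N − ((E N / N − e) + C b N / N) / κ → 1`. [folklore] -/
theorem eventually_half_mul_le {E b u m : ℕ → ℝ} {e κ C : ℝ} (hκ : 0 < κ)
    (hE : Tendsto (fun N : ℕ => E N / N) atTop (𝓝 e))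
    (hb : Tendsto (fun N : ℕ => b N / N) atTop (𝓝 0))
    (hgap : ∀ N : ℕ, (N : ℝ) * e + κ * u N - C * b N ≤ E N)
    (hcover : ∀ N : ℕ, (N : ℝ) ≤ b N + u N + m N) :
    ∀ᶠ N : ℕ in atTop, (1 / 2 : ℝ) * N ≤ m N := by
  have hf : Tendsto (fun N : ℕ => 1 - b N / N - ((E N / N - e) + C * (b N / N)) / κ)
      atTop (𝓝 1) := by
    have h1 : Tendsto (fun N : ℕ => E N / N - e) atTop (𝓝 0) := by
      simpa using hE.sub_const e
    have h2 : Tendsto (fun N : ℕ => ((E N / N - e) + C * (b N / N)) / κ) atTop (𝓝 0) := by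
      simpa using (h1.add (hb.const_mul C)).div_const κ
    have h3 : Tendsto (fun N : ℕ => (1 : ℝ) - b N / N) atTop (𝓝 1) := by
      simpa using hb.const_sub (1 : ℝ)
    simpa using h3.sub h2
  have hev : ∀ᶠ N : ℕ in atTop,
      (1 / 2 : ℝ) < 1 - b N / N - ((E N / N - e) + C * (b N / N)) / κ :=
    (tendsto_order.1 hf).1 _ (by norm_num)
  filter_upwards [hev, eventually_gt_atTop 0] with N hN hpos
  have hNr : (0 : ℝ) < N := by exact_mod_cast hpos
  have hu : u N ≤ (E N - N * e + C * b N) / κ := by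
    rw [le_div_iff₀ hκ]
    linarith [hgap N]
  have hid : (N : ℝ) * (1 - b N / N - ((E N / N - e) + C * (b N / N)) / κ)
      = N - b N - (E N - N * e + C * b N) / κ := by
    field_simp
  have hlt := mul_lt_mul_of_pos_left hN hNr
  rw [hid] at hlt
  linarith [hcover N]

/-! ### The stub -/

/-- **The squeeze** (stub `stub_hcpCharged_of_priced` of line Sketch for `StackingHinge`).  If the
priced inequality `N·e* + κ·#U − C·#B ≤ E_LJ(y)` holds for the hcp scale `(a, h)` (for all
`(δ₀, R, ε)`, on injective `δ₀`-separated configurations) and `ChargeFreeWindows` holds, then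
along every sequence of Lennard-Jones ground states and for every window `(R, ε)` the sites whose
`R`-window is two-way `ε`-matched with a rigid image of `barlowStacking a h alternatingHagg` have
positive upper density (density `≥ 1/2` eventually).  Proof: `δ₀` from
`LennardJonesMinimalDistance_holds`; `κ, L, C` from the hypothesis at `(δ₀, R, ε)`; ground states
are injective, `δ₀`-separated, with `interactionEnergy = groundStateEnergy`; `E(N)/N → e*`
(`ChargedEnergyGapNegative.crysEnergyLimit`), `#B/N → 0` (`ChargeFreeWindows` at radius `L`);
three-way cover `N ≤ #B + #U + #M` (`card_fin_le_three_cover`) and `eventually_half_mul_le`. [folklore] -/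
theorem stub_hcpCharged_of_priced : ∀ (a h : ℝ), (∀ δ₀ : ℝ, 0 < δ₀ → ∀ R ε : ℝ, 0 < R → 0 < ε → ∃ κ L C : ℝ, 0 < κ ∧ 0 < L ∧ ∀ (N : ℕ) (y : Fin N → EuclideanSpace ℝ (Fin 3)), Function.Injective y → (∀ i j : Fin N, i ≠ j → δ₀ ≤ dist (y i) (y j)) → (N : ℝ) * (⨅ Q : Literature.MathematicalPhysics.StatisticalMechanics.PeriodicConfiguration 3, Q.energyPerParticle Literature.MathematicalPhysics.StatisticalMechanics.lennardJones) + κ * (Nat.card {i : Fin N // (∀ j : Fin N, dist (y i) (y j) ≤ L * Literature.Geometry.DiscreteGeometry.nearestDist y i → Literature.Geometry.DiscreteGeometry.IsChargeFree (1 / 100 : ℝ) y j) ∧ ¬ ∃ g : EuclideanSpace ℝ (Fin 3) ≃ᵃⁱ[ℝ] EuclideanSpace ℝ (Fin 3), (∀ j : Fin N, dist (y i) (y j) ≤ R → ∃ z ∈ Literature.MathematicalPhysics.StatisticalMechanics.barlowStacking a h Literature.MathematicalPhysics.StatisticalMechanics.alternatingHagg, dist (y j) (g z) ≤ ε) ∧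 (∀ z ∈ Literature.MathematicalPhysics.StatisticalMechanics.barlowStacking a h Literature.MathematicalPhysics.StatisticalMechanics.alternatingHagg, dist (y i) (g z) ≤ R → ∃ j : Fin N, dist (y j) (g z) ≤ ε)} : ℝ) - C * (Nat.card {i : Fin N // ¬ ∀ j : Fin N, dist (y i) (y j) ≤ L * Literature.Geometry.DiscreteGeometry.nearestDist y i → Literature.Geometry.DiscreteGeometry.IsChargeFree (1 / 100 : ℝ) y j} : ℝ) ≤ Literature.MathematicalPhysics.StatisticalMechanics.interactionEnergy Literature.MathematicalPhysics.StatisticalMechanics.lennardJones y) → Summit.AtomisticToContinuum.Crystallization.Theses.PricedLinkCensus.ChargeFreeWindows → ∀ x : (N : ℕ) → (Fin N → EuclideanSpace ℝ (Fin 3)), (∀ N, Literature.MathematicalPhysics.StatisticalMechanics.IsGroundState Literature.MathematicalPhysics.StatisticalMechanics.lennardJones (x N)) → ∀ R ε : ℝ, 0 < R → 0 < ε → ∃ ρ : ℝ, 0 < ρ ∧ ∃ᶠ N : ℕ in Filter.atTop, ρ * (N : ℝ) ≤ (Nat.card {i : Fin N // ∃ g : EuclideanSpace ℝ (Fin 3)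 ≃ᵃⁱ[ℝ] EuclideanSpace ℝ (Fin 3), (∀ j : Fin N, dist (x N i) (x N j) ≤ R → ∃ z ∈ Literature.MathematicalPhysics.StatisticalMechanics.barlowStacking a h Literature.MathematicalPhysics.StatisticalMechanics.alternatingHagg, dist (x N j) (g z) ≤ ε) ∧ (∀ z ∈ Literature.MathematicalPhysics.StatisticalMechanics.barlowStacking a h Literature.MathematicalPhysics.StatisticalMechanics.alternatingHagg, dist (x N i) (g z) ≤ R → ∃ j : Fin N, dist (x N j) (g z) ≤ ε)} : ℝ) := by
  intro a h hP hCFW x hx R ε hR hε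
  obtain ⟨δ₀, hδ₀, hsep⟩ := LennardJonesMinimalDistance_holds
  obtain ⟨κ, L, C, hκ, hL, hgap⟩ := hP δ₀ hδ₀ R ε hR hε
  have hb := hCFW L hL x hx
  refine ⟨1 / 2, by norm_num, Filter.Eventually.frequently ?_⟩
  refine eventually_half_mul_le (E := fun N : ℕ => groundStateEnergy lennardJones 3 N)
    (u := fun N : ℕ => (Nat.card {i : Fin N //
      (∀ j : Fin N, dist (x N i) (x N j) ≤ L * nearestDist (x N) i →
        IsChargeFree (1 / 100 : ℝ) (x N) j) ∧
      ¬ ∃ g : EuclideanSpace ℝ (Fin 3) ≃ᵃⁱ[ℝ] EuclideanSpace ℝ (Fin 3),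
        (∀ j : Fin N, dist (x N i) (x N j) ≤ R →
          ∃ z ∈ barlowStacking a h alternatingHagg, dist (x N j) (g z) ≤ ε) ∧
        (∀ z ∈ barlowStacking a h alternatingHagg, dist (x N i) (g z) ≤ R →
          ∃ j : Fin N, dist (x N j) (g z) ≤ ε)} : ℝ))
    (C := C) hκ ChargedEnergyGapNegative.crysEnergyLimit hb (fun N => ?_) (fun N => ?_)
  · obtain ⟨hinj, hEq⟩ := hx N
    have h1 := hgap N (x N) hinj (fun i j hij => hsep N (x N) (hx N) i j hij)
    rw [hEq] at h1
    exact h1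
  · exact_mod_cast card_fin_le_three_cover N _ _

end Summit.AtomisticToContinuum.Crystallization.Theorems.PricedHcpWindowsSqueeze
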